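import Literature.MathematicalPhysics.KineticTheory.PseudoTrajectoryCoupling
import Literature.Analysis.FluidPDE.HardSphereOutgoingGood
import Literature.Analysis.FluidPDE.BoltzmannEquationProofs
import HarnessLib

/-!
# The regularity input (Reg): almost every configuration has BBGKY pseudo-trajectories that
# are well defined to all depths (BGSR 2016 p. 15, after Simonella 2014)
(Bodineau–Gallagher–Saint-Raymond, Invent. Math. 203 (2016) = arXiv:1305.3397v2, §5.1 p. 15:
"From [Simonella] … one can check that `Ψ_{i+1}` is well defined up to a set of measure 0";
Cercignani–Illner–Pulvirenti 1994 App. 4.A; Gallagher–Saint-Raymond–Texier 2013 Prop. 4.1.1 and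
Ch. 5; trunk T-KINETIC, topic MathematicalPhysics/KineticTheory; layer B2d of the plan towards
the inputs (S), (R), (Reg) of `bodineau_gallagher_saintRaymond_linear_of_inputs` /
`bgsr_linearBoltzmannApprox_of_inputs`: this file DISCHARGES (Reg).)

The comparison of the BBGKY and Boltzmann hierarchies (`PseudoTrajectoryCoupling`,
`TaggedSphereMainTermComparison`) consumes, for almost every one-particle configuration `z`, the
recursive regularity predicate `bgsrRegular ε n 1 σ z` to all depths `n`: along the
pseudo-trajectories of the BBGKY hierarchy read at outgoing representatives (`outRep`) along the
regularised Alexander flow, the adjoined configurations which lie in the hard-sphere domain are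
good points of the `(k+1)`-sphere flow, for almost every creation time, every label and
`σ ⊗ dv`-almost every (impact direction, velocity). This file PROVES it for `0 < ε < 1/2`:

* `outRep_lossConfig_torus`, `outRep_gainConfig_torus` — on `T^d` the outgoing representative
  exchanges the loss and the gain configurations (the elastic reflection only depends on the line
  of the impact direction and is an involution);
* `bgsrRegular.mono` — regularity is antitone in the horizon;
* `measurableSet_bgsrRegular` — the regularity predicate defines measurable sets, jointly in the
  horizon and the configuration;
* `measurePreserving_scatterParams` — the scattering of the pair (partner velocity, adjoined
  velocity) at fixed impact direction preserves the Lebesgue measure of the parameters, which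
  reduces the incoming (loss) clause to the outgoing one;
* `ae_bgsrRegular_all` — **(Reg)**: for `d ≥ 2`, `0 < ε < 1/2`, every horizon `σ`, every level
  `k` and depth `n`, Lebesgue-almost every `k`-configuration is regular; in particular
  `∀ᵐ z : Config 1, ∀ n, bgsrRegular ε n 1 σ z` (`ae_bgsrRegular_one`), the hypothesis `hReg`
  of `bodineau_gallagher_saintRaymond_linear_of_inputs`. The depth induction runs the flux engine
  `ae_lossConfig_of_persistent` (`HardSphereOutgoingGood`) with the persistent property
  "good and regular to depth `n` for the horizon `h`" (Lebesgue-null failure set by Alexander's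
  theorem and the induction hypothesis; persistence by the group law of the regularised flow,
  `bgsrRegular.transport` and antitonicity), transports it along the measure-preserving backward
  flow to every creation time, and integrates over the creation times by Fubini.

## References

* T. Bodineau, I. Gallagher, L. Saint-Raymond, Invent. Math. 203 (2016), arXiv:1305.3397v2, §5.1
  p. 15.
* S. Simonella, *Evolution of correlation functions in the hard sphere dynamics*, J. Stat. Phys.
  155 (2014) 1191–1221, §3 (regularity of the BBGKY pseudo-trajectories).
* C. Cercignani, R. Illner, M. Pulvirenti, *The Mathematical Theory of Dilute Gases*, Springer
  (1994), App. 4.A.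
-/

open MeasureTheory Metric Set Filter Topology Function
open scoped InnerProductSpace ENNReal

namespace Literature.MathematicalPhysics.KineticTheory

noncomputable section

open Literature.Analysis.FunctionSpaces Literature.Analysis.FunctionSpaces.Torus
open Literature.Analysis.FluidPDE Literature.Analysis.FluidPDE.Torus

variable {d : Type*} [Fintype d]

/-! ## §1. The outgoing representative exchanges loss and gain configurations -/

section OutRep

variable {ε : ℝ} (hε : 0 < ε) (hε' : ε < 2⁻¹) {s : ℕ} (Z : Config s d (UnitAddTorus d)) (i : Fin s)
  (ω : sphere (0 : EuclideanSpace ℝ d) 1) (v : EuclideanSpace ℝ d)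

include hε hε'

/-- On `T^d` the separation vector of the partner and the adjoined sphere of a loss configuration
is `-ε ω` (chart of the minimal image, `ε < 1/2`). [folklore] -/
theorem sepVec_lossConfig_partner :
    (Torus.geometry d).sepVec (lossConfig (Torus.geometry d) ε Z i ω v (Fin.castAdd 1 i)).1
      (lossConfig (Torus.geometry d) ε Z i ω v (Fin.natAdd s 0)).1 = -(ε • (ω : EuclideanSpace ℝ d)) := by
  have hωn : ‖(ω : EuclideanSpace ℝ d)‖ = 1 := by simp
  have hε2 : ε < 1 / 2 := lt_of_lt_of_eq hε' (by norm_num)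
  have hmem : -(ε • (ω : EuclideanSpace ℝ d)) ∈ Torus.symCube d := by
    refine Torus.closedBall_subset_symCube hε2 ?_
    rw [mem_closedBall, dist_zero_right, norm_neg, norm_smul, hωn, mul_one, Real.norm_of_nonneg hε.le]
  rw [lossConfig_apply_castAdd, lossConfig_apply_last, Torus.geometry_translate, Torus.geometry_sepVec,
    show (Z i).1 - ((Z i).1 + proj (ε • (ω : EuclideanSpace ℝ d))) = proj (-(ε • (ω : EuclideanSpace ℝ d))) by
      rw [proj_neg]; abel]
  exact Alexander.reprSym_proj_of_mem_symCube hmem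

/-- **The outgoing representative of a loss configuration is the gain configuration** (torus,
`0 < ε < 1/2`, unit `ω`): the reflection in the direction `-εω` is the reflection in the
direction `ω`. [cite: BodineauGallagherSaintRaymondInvent2016, §3.1, p. 9] -/
theorem outRep_lossConfig_torus :
    outRep (Torus.geometry d) s i (lossConfig (Torus.geometry d) ε Z i ω v) =
      gainConfig (Torus.geometry d) ε Z i ω v := by
  have hne := castAdd_ne_natAdd i
  have hsep := sepVec_lossConfig_partner hε hε' Z i ω v
  have hrefl : reflectVel ((Torus.geometry d).sepVec (lossConfig (Torus.geometry d) ε Z i ω v (Fin.castAdd 1 i)).1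
      (lossConfig (Torus.geometry d) ε Z i ω v (Fin.natAdd s 0)).1) = reflectVel (ω : EuclideanSpace ℝ d) := by
    rw [hsep, show -(ε • (ω : EuclideanSpace ℝ d)) = (-ε) • (ω : EuclideanSpace ℝ d) by rw [neg_smul]]
    funext p
    exact reflectVel_smul (neg_ne_zero.2 hε.ne') _ p
  funext j
  refine Fin.addCases (fun j' => ?_) (fun j' => ?_) j
  · by_cases hj : j' = i
    · subst hj
      rw [outRep, collidePair_apply_left hne, hrefl, gainConfig_apply_castAdd]
      simp [lossConfig_apply_castAdd, lossConfig_apply_last]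
    · have h1 : Fin.castAdd 1 j' ≠ Fin.castAdd 1 i := fun h => hj (Fin.castAdd_injective _ _ h)
      have h2 : Fin.castAdd 1 j' ≠ Fin.natAdd s 0 := castAdd_ne_natAdd j'
      rw [outRep, collidePair_apply_of_ne h1 h2, gainConfig_apply_castAdd, lossConfig_apply_castAdd]
      simp [Function.update_of_ne hj]
  · obtain rfl : j' = 0 := Subsingleton.elim _ _
    rw [outRep, collidePair_apply_right, hrefl, gainConfig_apply_last]
    simp [lossConfig_apply_castAdd, lossConfig_apply_last]

/-- **The outgoing representative of a gain configuration is the loss configuration**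
(involutivity of the elastic reflection). [cite: BodineauGallagherSaintRaymondInvent2016, §3.1, p. 9] -/
theorem outRep_gainConfig_torus :
    outRep (Torus.geometry d) s i (gainConfig (Torus.geometry d) ε Z i ω v) =
      lossConfig (Torus.geometry d) ε Z i ω v := by
  rw [← outRep_lossConfig_torus hε hε' Z i ω v, outRep, outRep, collidePair_collidePair (castAdd_ne_natAdd i)]

/-- The gain configuration lies in the hard-sphere domain iff the loss configuration does
(same positions). [folklore] -/
theorem gainConfig_mem_hardSphereDomain_iff :
    gainConfig (Torus.geometry d) ε Z i ω v ∈ hardSphereDomain (Torus.geometry d) (s + 1) ε ↔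
      lossConfig (Torus.geometry d) ε Z i ω v ∈ hardSphereDomain (Torus.geometry d) (s + 1) ε := by
  rw [← outRep_lossConfig_torus hε hε' Z i ω v, outRep_mem_hardSphereDomain_iff]

end OutRep

/-! ## §2. Regularity is antitone in the horizon -/

/-- **Regularity is antitone in the horizon**: a configuration regular to depth `n` for the
horizon `σ` is regular to depth `n` for every horizon `σ' ≤ σ`. [folklore] -/
theorem bgsrRegular.mono {ε : ℝ} :
    ∀ {n k : ℕ} {σ σ' : ℝ} {Z : Config k d (UnitAddTorus d)}, bgsrRegular ε n k σ Z → σ' ≤ σ →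
      bgsrRegular ε n k σ' Z := by
  intro n
  induction n with
  | zero => intro k σ σ' Z _ _; trivial
  | succ n ih =>
    intro k σ σ' Z h hσ
    rw [bgsrRegular_succ_iff] at h ⊢
    filter_upwards [h] with s hs hsI i
    have hsI' : s ∈ Icc 0 σ := ⟨hsI.1, hsI.2.trans hσ⟩
    filter_upwards [hs hsI' i] with q hq
    refine ⟨fun hg hd => ⟨(hq.1 hg hd).1, ih (hq.1 hg hd).2 (by linarith)⟩,
      fun hl hd => ⟨(hq.2 hl hd).1, ih (hq.2 hl hd).2 (by linarith)⟩⟩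

/-! ## §3. Measurability of the regularity predicate -/

/-- **Almost-everywhere quantification of a measurable set is measurable**: for a measurable
`A ⊆ α × β` and an s-finite `ν`, `{a | ∀ᵐ b ∂ν, (a, b) ∈ A}` is measurable
(`measurable_measure_prodMk_left`). [folklore] -/
theorem measurableSet_setOf_ae_mem {α β : Type*} [MeasurableSpace α] [MeasurableSpace β] (ν : Measure β) [SFinite ν]
    {A : Set (α × β)} (hA : MeasurableSet A) : MeasurableSet {a : α | ∀ᵐ b ∂ν, (a, b) ∈ A} := by
  have h : {a : α | ∀ᵐ b ∂ν, (a, b) ∈ A} = (fun a => ν (Prod.mk a ⁻¹' Aᶜ)) ⁻¹' {0} := by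
    ext a
    simp only [mem_setOf_eq, mem_preimage, mem_singleton_iff, ae_iff]
    rfl
  rw [h]
  exact (measurable_measure_prodMk_left hA.compl) (measurableSet_singleton 0)

/-- An implication between measurable predicates is a measurable predicate. [folklore] -/
theorem measurableSet_imp {α : Type*} [MeasurableSpace α] {p q : α → Prop} (hp : MeasurableSet {a | p a})
    (hq : MeasurableSet {a | q a}) : MeasurableSet {a | p a → q a} := by
  have : {a | p a → q a} = {a | p a}ᶜ ∪ {a | q a} := by
    ext a; simp only [mem_setOf_eq, mem_union, mem_compl_iff]; tauto
  rw [this]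
  exact hp.compl.union hq

section Measurability

variable {ε : ℝ} (hε : 0 < ε) (hε' : ε < 2⁻¹)

include hε hε'

/-- The ingredients of one clause of the regularity predicate are jointly measurable: the
predicate "if the flux is positive (resp. negative) and the adjoined configuration built on
`Φ_{-s} W` lies in the domain then its outgoing representative is good and belongs to a given
measurable set of (horizon, configuration) pairs with the horizon `h - s`", as a set of
`((h, W), s, (ω, v))`. [folklore] -/
theorem measurableSet_regularityClause {k : ℕ} (i : Fin k) {R : Set (ℝ × Config (k + 1) d (UnitAddTorus d))}
    (hR : MeasurableSet R) :
    MeasurableSet {x : (ℝ × Config k d (UnitAddTorus d)) × (ℝ × (sphere (0 : EuclideanSpace ℝ d) 1 × EuclideanSpace ℝ d)) |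
      (0 < ⟪(x.2.2.1 : EuclideanSpace ℝ d), x.2.2.2 - (Alexander.regFlow (Torus.geometry d) ε (-x.2.1) x.1.2 i).2⟫_ℝ →
        gainConfig (Torus.geometry d) ε (Alexander.regFlow (Torus.geometry d) ε (-x.2.1) x.1.2) i x.2.2.1 x.2.2.2 ∈
          hardSphereDomain (Torus.geometry d) (k + 1) ε →
        outRep (Torus.geometry d) k i
            (gainConfig (Torus.geometry d) ε (Alexander.regFlow (Torus.geometry d) ε (-x.2.1) x.1.2) i x.2.2.1 x.2.2.2) ∈
          Alexander.good (Torus.geometry d) ε ∧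
        (x.1.1 - x.2.1, outRep (Torus.geometry d) k i
            (gainConfig (Torus.geometry d) ε (Alexander.regFlow (Torus.geometry d) ε (-x.2.1) x.1.2) i x.2.2.1 x.2.2.2)) ∈ R) ∧
      (⟪(x.2.2.1 : EuclideanSpace ℝ d), x.2.2.2 - (Alexander.regFlow (Torus.geometry d) ε (-x.2.1) x.1.2 i).2⟫_ℝ < 0 →
        lossConfig (Torus.geometry d) ε (Alexander.regFlow (Torus.geometry d) ε (-x.2.1) x.1.2) i x.2.2.1 x.2.2.2 ∈
          hardSphereDomain (Torus.geometry d) (k + 1) ε →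
        outRep (Torus.geometry d) k i
            (lossConfig (Torus.geometry d) ε (Alexander.regFlow (Torus.geometry d) ε (-x.2.1) x.1.2) i x.2.2.1 x.2.2.2) ∈
          Alexander.good (Torus.geometry d) ε ∧
        (x.1.1 - x.2.1, outRep (Torus.geometry d) k i
            (lossConfig (Torus.geometry d) ε (Alexander.regFlow (Torus.geometry d) ε (-x.2.1) x.1.2) i x.2.2.1 x.2.2.2)) ∈ R)} := by
  have hGm := Torus.isMeasurable_geometry (d := d)
  have hgood : MeasurableSet (Alexander.good (N := k + 1) (Torus.geometry d) ε) :=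
    (Alexander.regHardSphereFlow (d := d) hε hε' (k + 1)).measurableSet_good
  have hD : MeasurableSet (hardSphereDomain (Torus.geometry d) (k + 1) ε) :=
    measurableSet_hardSphereDomain _ Torus.measurable_geometry_sepVec (k + 1) ε
  -- the transported configuration `Φ_{-s} W` and the parameters
  have hZ : Measurable fun x : (ℝ × Config k d (UnitAddTorus d)) × (ℝ × (sphere (0 : EuclideanSpace ℝ d) 1 × EuclideanSpace ℝ d)) =>
      Alexander.regFlow (Torus.geometry d) ε (-x.2.1) x.1.2 :=
    (Alexander.measurable_regFlow_uncurry (N := k) hε').comp (measurable_snd.fst.neg.prodMk measurable_fst.snd)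
  have hω : Measurable fun x : (ℝ × Config k d (UnitAddTorus d)) × (ℝ × (sphere (0 : EuclideanSpace ℝ d) 1 × EuclideanSpace ℝ d)) =>
      (x.2.2.1 : EuclideanSpace ℝ d) := measurable_subtype_coe.comp measurable_snd.snd.fst
  have hv : Measurable fun x : (ℝ × Config k d (UnitAddTorus d)) × (ℝ × (sphere (0 : EuclideanSpace ℝ d) 1 × EuclideanSpace ℝ d)) =>
      x.2.2.2 := measurable_snd.snd.snd
  have hflux : Measurable fun x : (ℝ × Config k d (UnitAddTorus d)) × (ℝ × (sphere (0 : EuclideanSpace ℝ d) 1 × EuclideanSpace ℝ d)) =>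
      ⟪(x.2.2.1 : EuclideanSpace ℝ d), x.2.2.2 - (Alexander.regFlow (Torus.geometry d) ε (-x.2.1) x.1.2 i).2⟫_ℝ :=
    hω.inner (hv.sub ((measurable_pi_apply i).comp hZ).snd)
  have hgain := measurable_gainConfig hGm.measurable_translate ε i hZ hω hv
  have hloss := measurable_lossConfig hGm.measurable_translate ε i hZ hω hv
  have hog := (measurable_outRep hGm k i).comp hgain
  have hol := (measurable_outRep hGm k i).comp hloss
  have hh : Measurable fun x : (ℝ × Config k d (UnitAddTorus d)) × (ℝ × (sphere (0 : EuclideanSpace ℝ d) 1 × EuclideanSpace ℝ d)) =>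
      x.1.1 - x.2.1 := measurable_fst.fst.sub measurable_snd.fst
  refine MeasurableSet.inter ?_ ?_
  · refine measurableSet_imp (measurableSet_lt measurable_const hflux) (measurableSet_imp (hD.preimage hgain) ?_)
    exact (hgood.preimage hog).inter (hR.preimage (hh.prodMk hog))
  · refine measurableSet_imp (measurableSet_lt hflux measurable_const) (measurableSet_imp (hD.preimage hloss) ?_)
    exact (hgood.preimage hol).inter (hR.preimage (hh.prodMk hol))

/-- **The one-step regularity set is measurable**: given that depth-`n` regularity at level
`k + 1` defines a measurable set of (horizon, configuration) pairs, the set of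
`((h, W), s)` such that "if `s ∈ [0, h]` then, for every label and almost every
(impact direction, velocity), the depth-`(n+1)` clause holds at `Φ_{-s} W` with horizon `h - s`"
is measurable. [folklore] -/
theorem measurableSet_regularityStep {n k : ℕ}
    (hR : MeasurableSet {p : ℝ × Config (k + 1) d (UnitAddTorus d) | bgsrRegular ε n (k + 1) p.1 p.2}) :
    MeasurableSet {y : (ℝ × Config k d (UnitAddTorus d)) × ℝ | y.2 ∈ Icc 0 y.1.1 → ∀ i : Fin k,
      ∀ᵐ q ∂((sphereMeasure (E := EuclideanSpace ℝ d)).prod (volume : Measure (EuclideanSpace ℝ d))),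
        (0 < ⟪(q.1 : EuclideanSpace ℝ d), q.2 - (Alexander.regFlow (Torus.geometry d) ε (-y.2) y.1.2 i).2⟫_ℝ →
          gainConfig (Torus.geometry d) ε (Alexander.regFlow (Torus.geometry d) ε (-y.2) y.1.2) i q.1 q.2 ∈
            hardSphereDomain (Torus.geometry d) (k + 1) ε →
          outRep (Torus.geometry d) k i
              (gainConfig (Torus.geometry d) ε (Alexander.regFlow (Torus.geometry d) ε (-y.2) y.1.2) i q.1 q.2) ∈
            Alexander.good (Torus.geometry d) ε ∧
          bgsrRegular ε n (k + 1) (y.1.1 - y.2) (outRep (Torus.geometry d) k i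
            (gainConfig (Torus.geometry d) ε (Alexander.regFlow (Torus.geometry d) ε (-y.2) y.1.2) i q.1 q.2))) ∧
        (⟪(q.1 : EuclideanSpace ℝ d), q.2 - (Alexander.regFlow (Torus.geometry d) ε (-y.2) y.1.2 i).2⟫_ℝ < 0 →
          lossConfig (Torus.geometry d) ε (Alexander.regFlow (Torus.geometry d) ε (-y.2) y.1.2) i q.1 q.2 ∈
            hardSphereDomain (Torus.geometry d) (k + 1) ε →
          outRep (Torus.geometry d) k i
              (lossConfig (Torus.geometry d) ε (Alexander.regFlow (Torus.geometry d) ε (-y.2) y.1.2) i q.1 q.2) ∈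
            Alexander.good (Torus.geometry d) ε ∧
          bgsrRegular ε n (k + 1) (y.1.1 - y.2) (outRep (Torus.geometry d) k i
            (lossConfig (Torus.geometry d) ε (Alexander.regFlow (Torus.geometry d) ε (-y.2) y.1.2) i q.1 q.2)))} := by
  haveI hσf : IsFiniteMeasure (sphereMeasure (E := EuclideanSpace ℝ d)) :=
    Literature.Analysis.FluidPDE.isFiniteMeasure_sphereMeasure (E := EuclideanSpace ℝ d)
  haveI hσs : SigmaFinite (sphereMeasure (E := EuclideanSpace ℝ d)) := @IsFiniteMeasure.toSigmaFinite _ _ _ hσf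
  haveI hκ : SFinite ((sphereMeasure (E := EuclideanSpace ℝ d)).prod (volume : Measure (EuclideanSpace ℝ d))) :=
    inferInstance
  -- the clause sets, reassociated to `(X × ℝ) × Q`, `X = ℝ × Config k`, `Q = S × ℝ^d`
  have hre : Measurable fun z : ((ℝ × Config k d (UnitAddTorus d)) × ℝ) × (sphere (0 : EuclideanSpace ℝ d) 1 × EuclideanSpace ℝ d) =>
      ((z.1.1, (z.1.2, z.2)) : (ℝ × Config k d (UnitAddTorus d)) × (ℝ × (sphere (0 : EuclideanSpace ℝ d) 1 × EuclideanSpace ℝ d))) :=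
    measurable_fst.fst.prodMk (measurable_fst.snd.prodMk measurable_snd)
  have hA := fun i : Fin k => (measurableSet_regularityClause hε hε' i hR).preimage hre
  -- (1) quantify over `q = (ω, v)`
  have hD := fun i : Fin k => measurableSet_setOf_ae_mem
    ((sphereMeasure (E := EuclideanSpace ℝ d)).prod (volume : Measure (EuclideanSpace ℝ d))) (hA i)
  -- (2) all labels
  have hDall := MeasurableSet.iInter hD
  rw [← Set.setOf_forall] at hDall
  -- (3) the time condition `s ∈ [0, h]`
  have hI : MeasurableSet {y : (ℝ × Config k d (UnitAddTorus d)) × ℝ | y.2 ∈ Icc 0 y.1.1} := by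
    have : {y : (ℝ × Config k d (UnitAddTorus d)) × ℝ | y.2 ∈ Icc 0 y.1.1} = {y | 0 ≤ y.2} ∩ {y | y.2 ≤ y.1.1} := by
      ext y; simp [mem_Icc]
    rw [this]
    exact (measurableSet_le measurable_const measurable_snd).inter (measurableSet_le measurable_snd measurable_fst.fst)
  have hF := measurableSet_imp hI hDall
  convert hF using 1
  ext y
  simp only [mem_setOf_eq, mem_preimage]

/-- **The regularity predicate defines measurable sets**, jointly in (horizon, configuration),
at every depth and level (induction on the depth: almost-everywhere quantifiers of measurable
sets in products with s-finite measures are measurable, `measurableSet_setOf_ae_mem`). [folklore] -/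
theorem measurableSet_bgsrRegular :
    ∀ (n k : ℕ), MeasurableSet {p : ℝ × Config k d (UnitAddTorus d) | bgsrRegular ε n k p.1 p.2} := by
  intro n
  induction n with
  | zero => intro k; simp [bgsrRegular]
  | succ n ih =>
    intro k
    have hB := measurableSet_setOf_ae_mem (volume : Measure ℝ) (measurableSet_regularityStep hε hε' (ih (k + 1)))
    convert hB using 1
    ext p
    simp only [mem_setOf_eq]
    rw [bgsrRegular_succ_iff]

end Measurability

/-! ## §4. The scattering of the parameters preserves their Lebesgue measure -/

section Scatter

variable {X : Type*} [MeasureSpace X] [SigmaFinite (volume : Measure X)] {m : ℕ} (i : Fin (m + 1))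
  (ω : sphere (0 : EuclideanSpace ℝ d) 1)

/-- **The scattering of the parameters** (partner velocity, adjoined velocity) of an adjunction at
fixed impact direction `ω`: `(Z, v) ↦ (Z with v_i ↦ v_i*, v*)`, `(v_i*, v*) = collide ω (v_i, v)`;
it turns the gain configuration into a loss configuration (`gainConfig_eq_lossConfig_scatterParams`).
[cite: BodineauGallagherSaintRaymondInvent2016, §3.1, p. 9] -/
def scatterParams (p : Config (m + 1) d X × EuclideanSpace ℝ d) : Config (m + 1) d X × EuclideanSpace ℝ d :=
  (Function.update p.1 i ((p.1 i).1, (collide ω ((p.1 i).2, p.2)).1), (collide ω ((p.1 i).2, p.2)).2)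

omit [MeasureSpace X] [SigmaFinite (volume : Measure X)] in
/-- The gain configuration is the loss configuration of the scattered parameters. [folklore] -/
theorem gainConfig_eq_lossConfig_scatterParams (G : Geometry d X) (ε : ℝ) (Z : Config (m + 1) d X)
    (v : EuclideanSpace ℝ d) :
    gainConfig G ε Z i ω v =
      lossConfig G ε (scatterParams i ω (Z, v)).1 i ω (scatterParams i ω (Z, v)).2 := by
  simp only [gainConfig, lossConfig, scatterParams, Function.update_self, reflectVel_eq_collide]

omit [MeasureSpace X] [SigmaFinite (volume : Measure X)] in
/-- The flux changes sign under the scattering: `⟪v* - v_i*, ω⟫ = -⟪v - v_i, ω⟫`. [folklore] -/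
theorem inner_scatterParams (Z : Config (m + 1) d X) (v : EuclideanSpace ℝ d) :
    ⟪(scatterParams i ω (Z, v)).2 - ((scatterParams i ω (Z, v)).1 i).2, (ω : EuclideanSpace ℝ d)⟫_ℝ =
      -⟪v - (Z i).2, (ω : EuclideanSpace ℝ d)⟫_ℝ := by
  have hω : ⟪(ω : EuclideanSpace ℝ d), (ω : EuclideanSpace ℝ d)⟫_ℝ = 1 := by
    rw [real_inner_self_eq_norm_sq]; simp
  simp only [scatterParams, Function.update_self, collide]
  simp only [inner_sub_left, inner_add_left, inner_smul_left, RCLike.conj_to_real, hω]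
  ring

omit [MeasureSpace X] [SigmaFinite (volume : Measure X)] in
/-- The scattering of the parameters does not move the particles. [folklore] -/
theorem scatterParams_fst_apply_fst (p : Config (m + 1) d X × EuclideanSpace ℝ d) (j : Fin (m + 1)) :
    ((scatterParams i ω p).1 j).1 = (p.1 j).1 := by
  by_cases hj : j = i
  · subst hj; simp [scatterParams]
  · simp [scatterParams, Function.update_of_ne hj]

/-- The coordinates used to isolate the pair of scattered velocities:
`(Z, v) ↦ (x_i, (Z without particle i, (v_i, v)))`. [folklore] -/
def scatterChart : Config (m + 1) d X × EuclideanSpace ℝ d ≃ᵐ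
    X × (Config m d X × (EuclideanSpace ℝ d × EuclideanSpace ℝ d)) :=
  (MeasurableEquiv.prodCongr (MeasurableEquiv.piFinSuccAbove (fun _ => X × EuclideanSpace ℝ d) i)
      (MeasurableEquiv.refl (EuclideanSpace ℝ d))).trans <|
    MeasurableEquiv.prodAssoc.trans <|
      MeasurableEquiv.prodAssoc.trans <|
        MeasurableEquiv.prodCongr (MeasurableEquiv.refl X)
          (MeasurableEquiv.prodAssoc.symm.trans <|
            (MeasurableEquiv.prodCongr MeasurableEquiv.prodComm (MeasurableEquiv.refl (EuclideanSpace ℝ d))).trans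
              MeasurableEquiv.prodAssoc)

/-- The chart preserves the Lebesgue measures. [folklore] -/
theorem measurePreserving_scatterChart :
    MeasurePreserving (scatterChart (X := X) (d := d) i) ((volume : Measure (Config (m + 1) d X)).prod volume)
      ((volume : Measure X).prod ((volume : Measure (Config m d X)).prod
        ((volume : Measure (EuclideanSpace ℝ d)).prod (volume : Measure (EuclideanSpace ℝ d))))) := by
  haveI hXE : SigmaFinite (volume : Measure (X × EuclideanSpace ℝ d)) := inferInstance
  haveI hC : SigmaFinite (volume : Measure (Config m d X)) := inferInstance
  have he := measurePreserving_piFinSuccAbove (fun _ : Fin (m + 1) => (volume : Measure (X × EuclideanSpace ℝ d))) i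
  rw [← MeasureTheory.volume_pi, ← MeasureTheory.volume_pi] at he
  have h0 : MeasurePreserving
      (MeasurableEquiv.prodCongr (MeasurableEquiv.piFinSuccAbove (fun _ => X × EuclideanSpace ℝ d) i)
        (MeasurableEquiv.refl (EuclideanSpace ℝ d)))
      ((volume : Measure (Config (m + 1) d X)).prod volume)
      (((volume : Measure (X × EuclideanSpace ℝ d)).prod (volume : Measure (Config m d X))).prod
        (volume : Measure (EuclideanSpace ℝ d))) :=
    he.prod (MeasurePreserving.id volume)
  have h1 := measurePreserving_prodAssoc (volume : Measure (X × EuclideanSpace ℝ d)) (volume : Measure (Config m d X))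
    (volume : Measure (EuclideanSpace ℝ d))
  rw [Measure.volume_eq_prod] at h1
  have h2 := measurePreserving_prodAssoc (volume : Measure X) (volume : Measure (EuclideanSpace ℝ d))
    ((volume : Measure (Config m d X)).prod (volume : Measure (EuclideanSpace ℝ d)))
  have g1 := (measurePreserving_prodAssoc (volume : Measure (EuclideanSpace ℝ d)) (volume : Measure (Config m d X))
    (volume : Measure (EuclideanSpace ℝ d))).symm MeasurableEquiv.prodAssoc
  have g2 : MeasurePreserving (MeasurableEquiv.prodCongr MeasurableEquiv.prodComm (MeasurableEquiv.refl (EuclideanSpace ℝ d)))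
      (((volume : Measure (EuclideanSpace ℝ d)).prod (volume : Measure (Config m d X))).prod (volume : Measure (EuclideanSpace ℝ d)))
      (((volume : Measure (Config m d X)).prod (volume : Measure (EuclideanSpace ℝ d))).prod (volume : Measure (EuclideanSpace ℝ d))) :=
    (Measure.measurePreserving_swap).prod (MeasurePreserving.id volume)
  have g3 := measurePreserving_prodAssoc (volume : Measure (Config m d X)) (volume : Measure (EuclideanSpace ℝ d))
    (volume : Measure (EuclideanSpace ℝ d))
  have g := (g3.comp g2).comp g1
  have h3 : MeasurePreserving (MeasurableEquiv.prodCongr (MeasurableEquiv.refl X)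
      (MeasurableEquiv.prodAssoc.symm.trans <|
        (MeasurableEquiv.prodCongr MeasurableEquiv.prodComm (MeasurableEquiv.refl (EuclideanSpace ℝ d))).trans
          MeasurableEquiv.prodAssoc))
      ((volume : Measure X).prod ((volume : Measure (EuclideanSpace ℝ d)).prod
        ((volume : Measure (Config m d X)).prod (volume : Measure (EuclideanSpace ℝ d)))))
      ((volume : Measure X).prod ((volume : Measure (Config m d X)).prod
        ((volume : Measure (EuclideanSpace ℝ d)).prod (volume : Measure (EuclideanSpace ℝ d))))) :=
    (MeasurePreserving.id volume).prod g
  exact ((h3.comp h2).comp h1).comp h0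

/-- **The scattering of the parameters preserves Lebesgue measure** on
`Config (m+1) × ℝ^d` (in the chart it is the collision change of variables `collide ω` on the
pair of velocities, of unit Jacobian — `measurePreserving_collideSwap` — times identities).
[cite: CIP1994, §3.1 p. 35] -/
theorem measurePreserving_scatterParams :
    MeasurePreserving (scatterParams (X := X) i ω) ((volume : Measure (Config (m + 1) d X)).prod volume)
      ((volume : Measure (Config (m + 1) d X)).prod volume) := by
  haveI hXE : SigmaFinite (volume : Measure (X × EuclideanSpace ℝ d)) := inferInstance
  haveI hC : SigmaFinite (volume : Measure (Config m d X)) := inferInstance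
  -- the collision law on the pair of velocities
  have hcol : MeasurePreserving (collide ω) ((volume : Measure (EuclideanSpace ℝ d)).prod volume)
      ((volume : Measure (EuclideanSpace ℝ d)).prod volume) := by
    have h1 := Literature.Analysis.FluidPDE.measurePreserving_collideSwap (E := EuclideanSpace ℝ d) ω
    have h3 := (Measure.measurePreserving_swap (μ := (volume : Measure (EuclideanSpace ℝ d)))
      (ν := (volume : Measure (EuclideanSpace ℝ d)))).comp h1
    have hfun : (Prod.swap ∘ fun p : EuclideanSpace ℝ d × EuclideanSpace ℝ d => (collide ω p).swap) = collide ω := by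
      funext p; simp
    rwa [hfun] at h3
  have hC : MeasurePreserving (Prod.map (id : X → X) (Prod.map (id : Config m d X → Config m d X) (collide ω)))
      ((volume : Measure X).prod ((volume : Measure (Config m d X)).prod
        ((volume : Measure (EuclideanSpace ℝ d)).prod (volume : Measure (EuclideanSpace ℝ d)))))
      ((volume : Measure X).prod ((volume : Measure (Config m d X)).prod
        ((volume : Measure (EuclideanSpace ℝ d)).prod (volume : Measure (EuclideanSpace ℝ d))))) :=
    (MeasurePreserving.id volume).prod ((MeasurePreserving.id volume).prod hcol)
  have hΦ := measurePreserving_scatterChart (X := X) (d := d) i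
  have key := (hΦ.symm _).comp (hC.comp hΦ)
  have hfun : ((scatterChart (X := X) (d := d) i).symm ∘
      Prod.map (id : X → X) (Prod.map (id : Config m d X → Config m d X) (collide ω)) ∘ (scatterChart (X := X) (d := d) i)) =
      scatterParams i ω := by
    funext p
    obtain ⟨Z, v⟩ := p
    have h1 : scatterChart (X := X) (d := d) i (Z, v) = ((Z i).1, (Fin.removeNth i Z, ((Z i).2, v))) := rfl
    have h2 : ∀ (x : X) (r : Config m d X) (a b : EuclideanSpace ℝ d),
        (scatterChart (X := X) (d := d) i).symm (x, (r, (a, b))) = (Fin.insertNth i (x, a) r, b) := fun _ _ _ _ => rfl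
    rw [Function.comp_apply, Function.comp_apply, h1]
    simp only [Prod.map_apply, id]
    rw [h2, Fin.insertNth_removeNth]
    rfl
  rw [← hfun]
  exact key

end Scatter

/-! ## §5. Persistence of "good and regular" along the outgoing free flight -/

section Persistence

variable {ε : ℝ} (hε : 0 < ε) (hε' : ε < 2⁻¹)

include hε hε'

omit hε hε' in
/-- Regularity for a negative horizon is vacuous. [folklore] -/
theorem bgsrRegular_of_neg {n k : ℕ} {σ : ℝ} (hσ : σ < 0) (Z : Config k d (UnitAddTorus d)) :
    bgsrRegular ε n k σ Z := by
  cases n with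
  | zero => trivial
  | succ n =>
    rw [bgsrRegular_succ_iff]
    refine ae_of_all _ fun s hs => ?_
    exact absurd (hs.1.trans hs.2) (not_le.2 hσ)

/-- **Persistence**: let `W₀` be an `(k)`-configuration whose free flight keeps all pairs at
distance `> ε` during `(0, τ]`, `0 < τ ≤ 1`, and which is NOT (good and regular to depth `n` for
the horizon `h`). Then `S_τ W₀` belongs to the Lebesgue-null set of configurations of the domain
which are not (good and regular to depth `n` for the horizon `h + 1`): if `S_τ W₀` is good then so
is `W₀` (`Alexander.mem_good_of_freeFlight_mem_good`); if moreover `S_τ W₀ = Φ_τ W₀` (free stretch)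
is regular for `h + 1` then `W₀ = Φ_{-τ} Φ_τ W₀` is regular for `h + 1 - τ ≥ h`
(`bgsrRegular.transport`, `bgsrRegular.mono`). [folklore] -/
theorem freeFlight_mem_of_not_goodRegular {n k : ℕ} {h : ℝ} {W₀ : Config k d (UnitAddTorus d)} {τ : ℝ}
    (hτ0 : 0 < τ) (hτ1 : τ ≤ 1)
    (hwin : ∀ u ∈ Ioc 0 τ, ∀ j l : Fin k, j ≠ l →
      ε < ‖(Torus.geometry d).sepVec (freeFlight (Torus.geometry d) u W₀ j).1 (freeFlight (Torus.geometry d) u W₀ l).1‖)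
    (hnot : ¬ (W₀ ∈ Alexander.good (N := k) (Torus.geometry d) ε ∧ bgsrRegular ε n k h W₀)) :
    freeFlight (Torus.geometry d) τ W₀ ∈ hardSphereDomain (Torus.geometry d) k ε ∩
      ((Alexander.good (N := k) (Torus.geometry d) ε)ᶜ ∪ {W | ¬ bgsrRegular ε n k (h + 1) W}) := by
  refine ⟨fun j l hjl => (hwin τ ⟨hτ0, le_rfl⟩ j l hjl).le, ?_⟩
  by_contra hc
  simp only [mem_union, mem_compl_iff, mem_setOf_eq, not_or, not_not] at hc
  obtain ⟨hgood, hreg⟩ := hc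
  apply hnot
  have hsep : ∀ u ∈ Ioc 0 τ, ∀ j l : Fin k, j ≠ l →
      ‖(Torus.geometry d).sepVec (freeFlight (Torus.geometry d) u W₀ j).1 (freeFlight (Torus.geometry d) u W₀ l).1‖ ≠ ε :=
    fun u hu j l hjl => (hwin u hu j l hjl).ne'
  have hW₀ : W₀ ∈ Alexander.good (N := k) (Torus.geometry d) ε :=
    Alexander.mem_good_of_freeFlight_mem_good hε hε' hτ0.le hsep hgood
  refine ⟨hW₀, ?_⟩
  rcases lt_or_ge h 0 with hh | hh
  · exact bgsrRegular_of_neg hh W₀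
  -- the free stretch: `Φ_τ W₀ = S_τ W₀`
  set Φ := Alexander.regHardSphereFlow (d := d) hε hε' k with hΦ
  have hflow : Alexander.regFlow (Torus.geometry d) ε τ W₀ = freeFlight (Torus.geometry d) τ W₀ := by
    have := Φ.flow_eq_freeFlight_of_freeFlight_ne Torus.continuous_geometry_translate (z := W₀) hW₀ hsep τ
      ⟨hτ0.le, le_rfl⟩
    simpa [hΦ] using this
  -- transport back by `τ` and shrink the horizon
  have ht := bgsrRegular.transport hε hε' hreg (s₀ := τ) ⟨hτ0.le, by linarith⟩
  rw [← hflow, ← Alexander.regFlow_add hε hε', neg_add_cancel, Alexander.regFlow_zero hε hε'] at ht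
  exact ht.mono (by linarith)

end Persistence

/-! ## §6. The depth induction: almost every configuration is regular -/

section Induction

variable {ε : ℝ} (hε : 0 < ε) (hε' : ε < 2⁻¹)

include hε hε'

/-- **Almost-everywhere statements are transported along the regularised flow** (it preserves
the Liouville measure and is the identity off the good set, which lies in the domain). [folklore] -/
theorem ae_comp_regFlow {k : ℕ} {Q : Config k d (UnitAddTorus d) → Prop}
    (hQ : ∀ᵐ Z : Config k d (UnitAddTorus d), Q Z) (t : ℝ) :
    ∀ᵐ Z : Config k d (UnitAddTorus d), Q (Alexander.regFlow (Torus.geometry d) ε t Z) := by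
  have hD : MeasurableSet (hardSphereDomain (Torus.geometry d) k ε) :=
    measurableSet_hardSphereDomain _ Torus.measurable_geometry_sepVec k ε
  have h1 : ∀ᵐ Z ∂(liouville (Torus.geometry d) k ε), Q Z := ae_restrict_of_ae hQ
  have h2 : ∀ᵐ Z ∂(liouville (Torus.geometry d) k ε), Q (Alexander.regFlow (Torus.geometry d) ε t Z) :=
    (Alexander.measurePreserving_regFlow (N := k) hε hε' t).quasiMeasurePreserving.ae h1
  rw [liouville, ae_restrict_iff' hD] at h2
  filter_upwards [hQ, h2] with Z hZ hZ'
  by_cases hZD : Z ∈ hardSphereDomain (Torus.geometry d) k ε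
  · exact hZ' hZD
  · have hng : Z ∉ Alexander.good (N := k) (Torus.geometry d) ε := fun hg => hZD (Alexander.good_subset_hardSphereDomain hg)
    rw [Alexander.regFlow_of_not_mem hng]
    exact hZ

/-- The set of parameters `(Z', (ω, w))` of the flux engine's statement — "outgoing, in the
domain ⇒ good and regular to depth `n` for the horizon `h`" — is measurable. [folklore] -/
theorem measurableSet_engineSet {m : ℕ} (i : Fin (m + 1)) (n : ℕ) (h : ℝ) :
    MeasurableSet {x : Config (m + 1) d (UnitAddTorus d) × (sphere (0 : EuclideanSpace ℝ d) 1 × EuclideanSpace ℝ d) |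
      0 < ⟪x.2.2 - (x.1 i).2, (x.2.1 : EuclideanSpace ℝ d)⟫_ℝ →
      lossConfig (Torus.geometry d) ε x.1 i x.2.1 x.2.2 ∈ hardSphereDomain (Torus.geometry d) (m + 1 + 1) ε →
      lossConfig (Torus.geometry d) ε x.1 i x.2.1 x.2.2 ∈ Alexander.good (N := m + 1 + 1) (Torus.geometry d) ε ∧
        bgsrRegular ε n (m + 1 + 1) h (lossConfig (Torus.geometry d) ε x.1 i x.2.1 x.2.2)} := by
  have hGm := Torus.isMeasurable_geometry (d := d)
  have hgood : MeasurableSet (Alexander.good (N := m + 1 + 1) (Torus.geometry d) ε) :=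
    (Alexander.regHardSphereFlow (d := d) hε hε' (m + 1 + 1)).measurableSet_good
  have hD : MeasurableSet (hardSphereDomain (Torus.geometry d) (m + 1 + 1) ε) :=
    measurableSet_hardSphereDomain _ Torus.measurable_geometry_sepVec (m + 1 + 1) ε
  have hR : MeasurableSet {W : Config (m + 1 + 1) d (UnitAddTorus d) | bgsrRegular ε n (m + 1 + 1) h W} :=
    (measurableSet_bgsrRegular hε hε' n (m + 1 + 1)).preimage (measurable_const.prodMk measurable_id)
  have hω : Measurable fun x : Config (m + 1) d (UnitAddTorus d) × (sphere (0 : EuclideanSpace ℝ d) 1 × EuclideanSpace ℝ d) =>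
      (x.2.1 : EuclideanSpace ℝ d) := measurable_subtype_coe.comp measurable_snd.fst
  have hw : Measurable fun x : Config (m + 1) d (UnitAddTorus d) × (sphere (0 : EuclideanSpace ℝ d) 1 × EuclideanSpace ℝ d) =>
      x.2.2 := measurable_snd.snd
  have hflux : Measurable fun x : Config (m + 1) d (UnitAddTorus d) × (sphere (0 : EuclideanSpace ℝ d) 1 × EuclideanSpace ℝ d) =>
      ⟪x.2.2 - (x.1 i).2, (x.2.1 : EuclideanSpace ℝ d)⟫_ℝ :=
    (hw.sub ((measurable_pi_apply i).comp measurable_fst).snd).inner hω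
  have hloss := measurable_lossConfig hGm.measurable_translate ε i measurable_fst hω hw
  exact measurableSet_imp (measurableSet_lt measurable_const hflux)
    (measurableSet_imp (hD.preimage hloss) ((hgood.preimage hloss).inter (hR.preimage hloss)))

omit hε hε' in
/-- The simultaneous scattering of the parameters at the impact direction read from the point,
`(Z', (ω, v)) ↦ (Z'', (ω, v*))`, preserves `dZ' ⊗ (σ ⊗ dv)` (a skew product over `σ` of the
measure-preserving scatterings `measurePreserving_scatterParams`). [folklore] -/
theorem measurePreserving_scatterSkew {m : ℕ} (i : Fin (m + 1)) :
    MeasurePreserving (fun x : Config (m + 1) d (UnitAddTorus d) × (sphere (0 : EuclideanSpace ℝ d) 1 × EuclideanSpace ℝ d) =>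
        ((scatterParams i x.2.1 (x.1, x.2.2)).1, (x.2.1, (scatterParams i x.2.1 (x.1, x.2.2)).2)))
      ((volume : Measure (Config (m + 1) d (UnitAddTorus d))).prod ((sphereMeasure (E := EuclideanSpace ℝ d)).prod volume))
      ((volume : Measure (Config (m + 1) d (UnitAddTorus d))).prod ((sphereMeasure (E := EuclideanSpace ℝ d)).prod volume)) := by
  haveI hσf : IsFiniteMeasure (sphereMeasure (E := EuclideanSpace ℝ d)) :=
    Literature.Analysis.FluidPDE.isFiniteMeasure_sphereMeasure (E := EuclideanSpace ℝ d)
  haveI hσs : SigmaFinite (sphereMeasure (E := EuclideanSpace ℝ d)) := @IsFiniteMeasure.toSigmaFinite _ _ _ hσf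
  haveI hXE : SigmaFinite (volume : Measure (UnitAddTorus d × EuclideanSpace ℝ d)) := inferInstance
  haveI hC : SigmaFinite (volume : Measure (Config (m + 1) d (UnitAddTorus d))) := inferInstance
  -- the skew product over `σ` on `S × (Config × ℝ^d)`
  have hsk : MeasurePreserving
      (fun y : sphere (0 : EuclideanSpace ℝ d) 1 × (Config (m + 1) d (UnitAddTorus d) × EuclideanSpace ℝ d) =>
        (id y.1, scatterParams i y.1 y.2))
      ((sphereMeasure (E := EuclideanSpace ℝ d)).prod ((volume : Measure (Config (m + 1) d (UnitAddTorus d))).prod volume))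
      ((sphereMeasure (E := EuclideanSpace ℝ d)).prod ((volume : Measure (Config (m + 1) d (UnitAddTorus d))).prod volume)) := by
    refine MeasurePreserving.skew_product (MeasurePreserving.id _) ?_
      (Eventually.of_forall fun ω => (measurePreserving_scatterParams (X := UnitAddTorus d) i ω).map_eq)
    -- joint measurability of `(ω, (Z, v)) ↦ scatterParams i ω (Z, v)`
    have hZ : Measurable fun y : sphere (0 : EuclideanSpace ℝ d) 1 × (Config (m + 1) d (UnitAddTorus d) × EuclideanSpace ℝ d) => y.2.1 :=
      measurable_snd.fst
    have hv : Measurable fun y : sphere (0 : EuclideanSpace ℝ d) 1 × (Config (m + 1) d (UnitAddTorus d) × EuclideanSpace ℝ d) => y.2.2 :=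
      measurable_snd.snd
    have hωm : Measurable fun y : sphere (0 : EuclideanSpace ℝ d) 1 × (Config (m + 1) d (UnitAddTorus d) × EuclideanSpace ℝ d) =>
        (y.1 : EuclideanSpace ℝ d) := measurable_subtype_coe.comp measurable_fst
    have hvi : Measurable fun y : sphere (0 : EuclideanSpace ℝ d) 1 × (Config (m + 1) d (UnitAddTorus d) × EuclideanSpace ℝ d) =>
        (y.2.1 i).2 := ((measurable_pi_apply i).comp hZ).snd
    have hcol : Measurable fun y : sphere (0 : EuclideanSpace ℝ d) 1 × (Config (m + 1) d (UnitAddTorus d) × EuclideanSpace ℝ d) =>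
        collide y.1 ((y.2.1 i).2, y.2.2) := by
      have hc : Measurable fun q : EuclideanSpace ℝ d × (EuclideanSpace ℝ d × EuclideanSpace ℝ d) =>
          (q.2.1 - ⟪q.2.1 - q.2.2, q.1⟫_ℝ • q.1, q.2.2 + ⟪q.2.1 - q.2.2, q.1⟫_ℝ • q.1) := by fun_prop
      exact hc.comp (hωm.prodMk (hvi.prodMk hv))
    refine Measurable.prodMk ?_ hcol.snd
    refine measurable_pi_lambda _ fun j => ?_
    by_cases hj : j = i
    · subst hj
      simp only [Function.update_self]
      exact ((measurable_pi_apply j).comp hZ).fst.prodMk hcol.fst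
    · simp only [Function.update_of_ne hj]
      exact (measurable_pi_apply j).comp hZ
  -- conjugate by the rearrangement `(Z', (ω, v)) ↦ (ω, (Z', v))`
  set ρ : Config (m + 1) d (UnitAddTorus d) × (sphere (0 : EuclideanSpace ℝ d) 1 × EuclideanSpace ℝ d) ≃ᵐ
      sphere (0 : EuclideanSpace ℝ d) 1 × (Config (m + 1) d (UnitAddTorus d) × EuclideanSpace ℝ d) :=
    MeasurableEquiv.prodAssoc.symm.trans
      ((MeasurableEquiv.prodCongr MeasurableEquiv.prodComm (MeasurableEquiv.refl (EuclideanSpace ℝ d))).trans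
        MeasurableEquiv.prodAssoc) with hρ
  have hρm : MeasurePreserving ρ
      ((volume : Measure (Config (m + 1) d (UnitAddTorus d))).prod ((sphereMeasure (E := EuclideanSpace ℝ d)).prod volume))
      ((sphereMeasure (E := EuclideanSpace ℝ d)).prod ((volume : Measure (Config (m + 1) d (UnitAddTorus d))).prod volume)) := by
    have g1 := (measurePreserving_prodAssoc (volume : Measure (Config (m + 1) d (UnitAddTorus d)))
      (sphereMeasure (E := EuclideanSpace ℝ d)) (volume : Measure (EuclideanSpace ℝ d))).symm MeasurableEquiv.prodAssoc
    have g2 : MeasurePreserving (MeasurableEquiv.prodCongr MeasurableEquiv.prodComm (MeasurableEquiv.refl (EuclideanSpace ℝ d)))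
        (((volume : Measure (Config (m + 1) d (UnitAddTorus d))).prod (sphereMeasure (E := EuclideanSpace ℝ d))).prod volume)
        (((sphereMeasure (E := EuclideanSpace ℝ d)).prod (volume : Measure (Config (m + 1) d (UnitAddTorus d)))).prod volume) :=
      (Measure.measurePreserving_swap).prod (MeasurePreserving.id volume)
    have g3 := measurePreserving_prodAssoc (sphereMeasure (E := EuclideanSpace ℝ d))
      (volume : Measure (Config (m + 1) d (UnitAddTorus d))) (volume : Measure (EuclideanSpace ℝ d))
    exact (g3.comp g2).comp g1
  have key := (hρm.symm _).comp (hsk.comp hρm)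
  have hfun : (ρ.symm ∘ (fun y : sphere (0 : EuclideanSpace ℝ d) 1 × (Config (m + 1) d (UnitAddTorus d) × EuclideanSpace ℝ d) =>
      (id y.1, scatterParams i y.1 y.2)) ∘ ρ) =
      fun x => ((scatterParams i x.2.1 (x.1, x.2.2)).1, (x.2.1, (scatterParams i x.2.1 (x.1, x.2.2)).2)) := by
    funext x
    rfl
  rw [hfun] at key
  exact key

/-- **The depth-`(n+1)` clause at a fixed creation time** (the core of the induction step). If
depth-`n` regularity holds Lebesgue-almost everywhere at every level and horizon, then for every
label `i` and horizon `h`, for almost every `k`-configuration `Z'` and `σ ⊗ dv`-almost every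
(impact direction, velocity): in the gain case (`⟪ω, v - v_i⟫ > 0`) as in the loss case
(`⟪ω, v - v_i⟫ < 0`), if the adjoined configuration lies in the domain then its outgoing
representative is good and regular to depth `n` for the horizon `h`. The gain case is the flux
engine `ae_lossConfig_of_persistent` with the persistent property "good and regular"
(`freeFlight_mem_of_not_goodRegular`) and `outRep ∘ gainConfig = lossConfig`; the loss case is
the same statement at the scattered parameters (`outRep ∘ lossConfig = gainConfig`,
`measurePreserving_scatterSkew`). [cite: BodineauGallagherSaintRaymondInvent2016, §5.1 p. 15] -/
theorem ae_regularityClause (hd : 2 ≤ Fintype.card d) {n : ℕ}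
    (IH : ∀ (k : ℕ) (h : ℝ), ∀ᵐ W : Config k d (UnitAddTorus d), bgsrRegular ε n k h W)
    {m : ℕ} (i : Fin (m + 1)) (h : ℝ) :
    ∀ᵐ Z' : Config (m + 1) d (UnitAddTorus d),
      ∀ᵐ q : sphere (0 : EuclideanSpace ℝ d) 1 × EuclideanSpace ℝ d
          ∂((sphereMeasure (E := EuclideanSpace ℝ d)).prod volume),
        (0 < ⟪(q.1 : EuclideanSpace ℝ d), q.2 - (Z' i).2⟫_ℝ →
          gainConfig (Torus.geometry d) ε Z' i q.1 q.2 ∈ hardSphereDomain (Torus.geometry d) (m + 1 + 1) ε →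
          outRep (Torus.geometry d) (m + 1) i (gainConfig (Torus.geometry d) ε Z' i q.1 q.2) ∈
            Alexander.good (Torus.geometry d) ε ∧
          bgsrRegular ε n (m + 1 + 1) h (outRep (Torus.geometry d) (m + 1) i (gainConfig (Torus.geometry d) ε Z' i q.1 q.2))) ∧
        (⟪(q.1 : EuclideanSpace ℝ d), q.2 - (Z' i).2⟫_ℝ < 0 →
          lossConfig (Torus.geometry d) ε Z' i q.1 q.2 ∈ hardSphereDomain (Torus.geometry d) (m + 1 + 1) ε →
          outRep (Torus.geometry d) (m + 1) i (lossConfig (Torus.geometry d) ε Z' i q.1 q.2) ∈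
            Alexander.good (Torus.geometry d) ε ∧
          bgsrRegular ε n (m + 1 + 1) h (outRep (Torus.geometry d) (m + 1) i (lossConfig (Torus.geometry d) ε Z' i q.1 q.2))) := by
  classical
  haveI hσf : IsFiniteMeasure (sphereMeasure (E := EuclideanSpace ℝ d)) :=
    Literature.Analysis.FluidPDE.isFiniteMeasure_sphereMeasure (E := EuclideanSpace ℝ d)
  haveI hσs : SigmaFinite (sphereMeasure (E := EuclideanSpace ℝ d)) := @IsFiniteMeasure.toSigmaFinite _ _ _ hσf
  haveI hXE : SigmaFinite (volume : Measure (UnitAddTorus d × EuclideanSpace ℝ d)) := inferInstance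
  haveI hC : SigmaFinite (volume : Measure (Config (m + 1) d (UnitAddTorus d))) := inferInstance
  set G := Torus.geometry d with hG
  -- the null pathological set of the persistent property "good and regular"
  set T : Set (Config (m + 1 + 1) d (UnitAddTorus d)) := hardSphereDomain G (m + 1 + 1) ε ∩
    ((Alexander.good (N := m + 1 + 1) G ε)ᶜ ∪ {W | ¬ bgsrRegular ε n (m + 1 + 1) (h + 1) W}) with hT
  have hgood : MeasurableSet (Alexander.good (N := m + 1 + 1) G ε) :=
    (Alexander.regHardSphereFlow (d := d) hε hε' (m + 1 + 1)).measurableSet_good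
  have hD : MeasurableSet (hardSphereDomain G (m + 1 + 1) ε) :=
    measurableSet_hardSphereDomain _ Torus.measurable_geometry_sepVec (m + 1 + 1) ε
  have hRm : MeasurableSet {W : Config (m + 1 + 1) d (UnitAddTorus d) | ¬ bgsrRegular ε n (m + 1 + 1) (h + 1) W} :=
    ((measurableSet_bgsrRegular hε hε' n (m + 1 + 1)).preimage (measurable_const.prodMk measurable_id)).compl
  have hTm : MeasurableSet T := hD.inter (hgood.compl.union hRm)
  have hT0 : volume T = 0 := by
    have h1 : volume (hardSphereDomain G (m + 1 + 1) ε ∩ (Alexander.good (N := m + 1 + 1) G ε)ᶜ) = 0 := by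
      have h : liouville G (m + 1 + 1) ε (Alexander.good (N := m + 1 + 1) G ε)ᶜ = 0 :=
        Alexander.torusFlow_ae_good_holds (d := d) hε hε' (m + 1 + 1)
      rw [liouville, Measure.restrict_apply hgood.compl] at h
      rwa [inter_comm] at h
    have h2 : volume {W : Config (m + 1 + 1) d (UnitAddTorus d) | ¬ bgsrRegular ε n (m + 1 + 1) (h + 1) W} = 0 := by
      have := IH (m + 1 + 1) (h + 1)
      rwa [ae_iff] at this
    refine measure_mono_null (fun W hW => ?_) (measure_union_null h1 h2)
    rcases hW.2 with hW2 | hW2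
    · exact Or.inl ⟨hW.1, hW2⟩
    · exact Or.inr hW2
  -- the flux engine
  have hE := ae_lossConfig_of_persistent (d := d) hd hε hε' i hTm hT0
    (fun W => W ∈ Alexander.good (N := m + 1 + 1) G ε ∧ bgsrRegular ε n (m + 1 + 1) h W)
    (fun W₀ τ hτ0 hτ1 hwin hnot => freeFlight_mem_of_not_goodRegular hε hε' hτ0 hτ1 hwin hnot)
  -- the engine set and its measurability
  set M : Set (Config (m + 1) d (UnitAddTorus d) × (sphere (0 : EuclideanSpace ℝ d) 1 × EuclideanSpace ℝ d)) :=
    {x | 0 < ⟪x.2.2 - (x.1 i).2, (x.2.1 : EuclideanSpace ℝ d)⟫_ℝ →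
      lossConfig G ε x.1 i x.2.1 x.2.2 ∈ hardSphereDomain G (m + 1 + 1) ε →
      lossConfig G ε x.1 i x.2.1 x.2.2 ∈ Alexander.good (N := m + 1 + 1) G ε ∧
        bgsrRegular ε n (m + 1 + 1) h (lossConfig G ε x.1 i x.2.1 x.2.2)} with hM
  have hMm : MeasurableSet M := measurableSet_engineSet hε hε' i n h
  -- (B1) product form of the engine's statement
  have hB1 : ∀ᵐ Z' : Config (m + 1) d (UnitAddTorus d),
      ∀ᵐ q ∂((sphereMeasure (E := EuclideanSpace ℝ d)).prod (volume : Measure (EuclideanSpace ℝ d))), (Z', q) ∈ M := by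
    filter_upwards [hE] with Z' hZ'
    have hmeas : MeasurableSet {y : EuclideanSpace ℝ d × sphere (0 : EuclideanSpace ℝ d) 1 | (Z', (y.2, y.1)) ∈ M} :=
      hMm.preimage (measurable_const.prodMk (measurable_snd.prodMk measurable_fst))
    have h1 := (Measure.ae_ae_comm (μ := (volume : Measure (EuclideanSpace ℝ d))) (ν := sphereMeasure (E := EuclideanSpace ℝ d))
      (p := fun (w : EuclideanSpace ℝ d) (ν : sphere (0 : EuclideanSpace ℝ d) 1) => (Z', (ν, w)) ∈ M) hmeas).1 hZ'
    have hmeas' : MeasurableSet {q : sphere (0 : EuclideanSpace ℝ d) 1 × EuclideanSpace ℝ d | (Z', q) ∈ M} :=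
      hMm.preimage (measurable_const.prodMk measurable_id)
    exact (Measure.ae_prod_iff_ae_ae (μ := sphereMeasure (E := EuclideanSpace ℝ d)) (ν := (volume : Measure (EuclideanSpace ℝ d)))
      hmeas').2 h1
  -- (B2) the scattered form
  have hprod : ∀ᵐ p ∂((volume : Measure (Config (m + 1) d (UnitAddTorus d))).prod
      ((sphereMeasure (E := EuclideanSpace ℝ d)).prod (volume : Measure (EuclideanSpace ℝ d)))), p ∈ M :=
    (Measure.ae_prod_iff_ae_ae hMm).2 hB1
  have hΞ := measurePreserving_scatterSkew (d := d) i
  have hprod' := hΞ.quasiMeasurePreserving.ae hprod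
  have hB2 := (Measure.ae_prod_iff_ae_ae (hMm.preimage hΞ.measurable)).1 hprod'
  -- combine and rewrite the two clauses
  filter_upwards [hB1, hB2] with Z' h1 h2
  filter_upwards [h1, h2] with q hq1 hq2
  simp only [hM, mem_setOf_eq] at hq1 hq2
  constructor
  · intro hflux hDom
    rw [outRep_gainConfig_torus hε hε']
    rw [gainConfig_mem_hardSphereDomain_iff hε hε'] at hDom
    exact hq1 (by rwa [real_inner_comm] at hflux) hDom
  · intro hflux hDom
    rw [outRep_lossConfig_torus hε hε', gainConfig_eq_lossConfig_scatterParams]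
    refine hq2 ?_ ?_
    · rw [inner_scatterParams, real_inner_comm]
      linarith
    · rw [← gainConfig_eq_lossConfig_scatterParams, gainConfig_mem_hardSphereDomain_iff hε hε']
      exact hDom

/-- **(Reg): almost every configuration is regular to every depth.** For `d ≥ 2`,
`0 < ε < 1/2`, every depth `n`, level `k` and horizon `σ`, Lebesgue-almost every `k`-configuration
of hard spheres on `T^d` is regular to depth `n` for the horizon `σ` (`bgsrRegular`): the BBGKY
pseudo-trajectories issued from it, read along the regularised Alexander flow at outgoing
representatives, are well defined to depth `n` for almost every choice of the creation
parameters. Induction on the depth: `ae_regularityClause` at every creation time `s`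
(transported along `Φ_{-s}`, `ae_comp_regFlow`), then Fubini over the creation times
(`measurableSet_regularityStep`). BGSR p. 15: "From [Simonella] … one can check that `Ψ_{i+1}`
is well defined up to a set of measure 0". [cite: BodineauGallagherSaintRaymondInvent2016, §5.1 p. 15] -/
theorem ae_bgsrRegular_all (hd : 2 ≤ Fintype.card d) :
    ∀ (n k : ℕ) (σ : ℝ), ∀ᵐ W : Config k d (UnitAddTorus d), bgsrRegular ε n k σ W := by
  intro n
  induction n with
  | zero => intro k σ; exact ae_of_all _ fun _ => trivial
  | succ n ih =>
    intro k σ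
    cases k with
    | zero =>
      refine ae_of_all _ fun Z => ?_
      rw [bgsrRegular_succ_iff]
      exact ae_of_all _ fun s _ i => i.elim0
    | succ m =>
      haveI hXE : SigmaFinite (volume : Measure (UnitAddTorus d × EuclideanSpace ℝ d)) := inferInstance
      haveI hC : SigmaFinite (volume : Measure (Config (m + 1) d (UnitAddTorus d))) := inferInstance
      -- the clause at every creation time, transported along the backward flow
      have hstep : ∀ s : ℝ, ∀ᵐ Z : Config (m + 1) d (UnitAddTorus d), ∀ i : Fin (m + 1),
          ∀ᵐ q : sphere (0 : EuclideanSpace ℝ d) 1 × EuclideanSpace ℝ d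
              ∂((sphereMeasure (E := EuclideanSpace ℝ d)).prod volume),
            (0 < ⟪(q.1 : EuclideanSpace ℝ d), q.2 - (Alexander.regFlow (Torus.geometry d) ε (-s) Z i).2⟫_ℝ →
              gainConfig (Torus.geometry d) ε (Alexander.regFlow (Torus.geometry d) ε (-s) Z) i q.1 q.2 ∈
                hardSphereDomain (Torus.geometry d) (m + 1 + 1) ε →
              outRep (Torus.geometry d) (m + 1) i
                  (gainConfig (Torus.geometry d) ε (Alexander.regFlow (Torus.geometry d) ε (-s) Z) i q.1 q.2) ∈
                Alexander.good (Torus.geometry d) ε ∧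
              bgsrRegular ε n (m + 1 + 1) (σ - s) (outRep (Torus.geometry d) (m + 1) i
                (gainConfig (Torus.geometry d) ε (Alexander.regFlow (Torus.geometry d) ε (-s) Z) i q.1 q.2))) ∧
            (⟪(q.1 : EuclideanSpace ℝ d), q.2 - (Alexander.regFlow (Torus.geometry d) ε (-s) Z i).2⟫_ℝ < 0 →
              lossConfig (Torus.geometry d) ε (Alexander.regFlow (Torus.geometry d) ε (-s) Z) i q.1 q.2 ∈
                hardSphereDomain (Torus.geometry d) (m + 1 + 1) ε →
              outRep (Torus.geometry d) (m + 1) i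
                  (lossConfig (Torus.geometry d) ε (Alexander.regFlow (Torus.geometry d) ε (-s) Z) i q.1 q.2) ∈
                Alexander.good (Torus.geometry d) ε ∧
              bgsrRegular ε n (m + 1 + 1) (σ - s) (outRep (Torus.geometry d) (m + 1) i
                (lossConfig (Torus.geometry d) ε (Alexander.regFlow (Torus.geometry d) ε (-s) Z) i q.1 q.2))) := by
        intro s
        have h0 := ae_all_iff.2 fun i : Fin (m + 1) => ae_regularityClause hε hε' hd ih i (σ - s)
        exact ae_comp_regFlow hε hε' h0 (-s)
      -- Fubini over the creation times
      set P : ℝ → Config (m + 1) d (UnitAddTorus d) → Prop := fun s Z => s ∈ Icc 0 σ → ∀ i : Fin (m + 1),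
          ∀ᵐ q : sphere (0 : EuclideanSpace ℝ d) 1 × EuclideanSpace ℝ d
              ∂((sphereMeasure (E := EuclideanSpace ℝ d)).prod volume),
            (0 < ⟪(q.1 : EuclideanSpace ℝ d), q.2 - (Alexander.regFlow (Torus.geometry d) ε (-s) Z i).2⟫_ℝ →
              gainConfig (Torus.geometry d) ε (Alexander.regFlow (Torus.geometry d) ε (-s) Z) i q.1 q.2 ∈
                hardSphereDomain (Torus.geometry d) (m + 1 + 1) ε →
              outRep (Torus.geometry d) (m + 1) i
                  (gainConfig (Torus.geometry d) ε (Alexander.regFlow (Torus.geometry d) ε (-s) Z) i q.1 q.2) ∈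
                Alexander.good (Torus.geometry d) ε ∧
              bgsrRegular ε n (m + 1 + 1) (σ - s) (outRep (Torus.geometry d) (m + 1) i
                (gainConfig (Torus.geometry d) ε (Alexander.regFlow (Torus.geometry d) ε (-s) Z) i q.1 q.2))) ∧
            (⟪(q.1 : EuclideanSpace ℝ d), q.2 - (Alexander.regFlow (Torus.geometry d) ε (-s) Z i).2⟫_ℝ < 0 →
              lossConfig (Torus.geometry d) ε (Alexander.regFlow (Torus.geometry d) ε (-s) Z) i q.1 q.2 ∈
                hardSphereDomain (Torus.geometry d) (m + 1 + 1) ε →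
              outRep (Torus.geometry d) (m + 1) i
                  (lossConfig (Torus.geometry d) ε (Alexander.regFlow (Torus.geometry d) ε (-s) Z) i q.1 q.2) ∈
                Alexander.good (Torus.geometry d) ε ∧
              bgsrRegular ε n (m + 1 + 1) (σ - s) (outRep (Torus.geometry d) (m + 1) i
                (lossConfig (Torus.geometry d) ε (Alexander.regFlow (Torus.geometry d) ε (-s) Z) i q.1 q.2)))
        with hP
      have hF := (measurableSet_regularityStep hε hε' (k := m + 1) (measurableSet_bgsrRegular hε hε' n (m + 1 + 1))).preimage
        (show Measurable fun p : ℝ × Config (m + 1) d (UnitAddTorus d) => (((σ, p.2) : ℝ × Config (m + 1) d (UnitAddTorus d)), p.1)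
          from (measurable_const.prodMk measurable_snd).prodMk measurable_fst)
      have hF' : MeasurableSet {x : ℝ × Config (m + 1) d (UnitAddTorus d) | P x.1 x.2} := hF
      have hall : ∀ᵐ s ∂(volume : Measure ℝ), ∀ᵐ Z : Config (m + 1) d (UnitAddTorus d), P s Z :=
        ae_of_all (volume : Measure ℝ) fun s => (hstep s).mono fun Z hZ (_ : s ∈ Icc 0 σ) => hZ
      have hcomm := (Measure.ae_ae_comm (μ := (volume : Measure ℝ)) (ν := (volume : Measure (Config (m + 1) d (UnitAddTorus d))))
        hF').1 hall
      filter_upwards [hcomm] with Z hZ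
      rw [bgsrRegular_succ_iff]
      exact hZ

/-- **The regularity input (Reg) of `bodineau_gallagher_saintRaymond_linear_of_inputs` /
`bgsr_linearBoltzmannApprox_of_inputs`**: for `d ≥ 2`, `0 < ε < 1/2` and every horizon `σ`,
almost every one-particle configuration is regular to all depths. [cite: BodineauGallagherSaintRaymondInvent2016, §5.1 p. 15] -/
theorem ae_bgsrRegular_one (hd : 2 ≤ Fintype.card d) (σ : ℝ) :
    ∀ᵐ z : Config 1 d (UnitAddTorus d), ∀ n, bgsrRegular ε n 1 σ z :=
  ae_all_iff.2 fun n => ae_bgsrRegular_all hε hε' hd n 1 σ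

end Induction

end

end Literature.MathematicalPhysics.KineticTheory
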